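import Mathlib
import Summits.Ventures.HodgeRepro2.PolydiscMeanValue
import Summits.Ventures.HodgeRepro2.FundamentalDomainUnfolding
import Summits.Ventures.HodgeRepro2.BergmanIntegral

/-!
# PeterssonSupBound — on a compact subset of the ball, a holomorphic weight-`k` form is bounded
by its Petersson norm

Blind cell `pub-hodge-repro2`, seat p2 (Tier 5 kernel support: towards the finite-dimensionality
of the holomorphic weight-`k` forms on the compact Picard modular surface).

For a compact quotient `S\𝔹²`, a compact `C ⊂ 𝔹²` and a measurable fundamental domain `D`, there
is a constant `c = c(C, S, D, k)` such that every holomorphic weight-`k` form `f` for `S` satisfies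

  `sup_{z ∈ C} ‖f z‖² ≤ c · ∫_D petersson k f dμ_B = c · ‖f‖²_Pet`.

Proof: `C` has a closed `r`-thickening `K' ⊂ 𝔹²`; the polydisc mean value bound
(`PolydiscMeanValue.norm_sq_le_integral_ball`) gives `‖f z‖² ≤ (πr²)⁻² ∫_{K'} ‖f‖² dLeb` for
`z ∈ C`; on `K'` the Lebesgue density `‖f‖²` is at most `M₁ ×` the Bergman–Petersson density
`volumeDensity · petersson k f` (`M₁ = sup_{K'} (1 − ‖z‖²)^{3−k}`), so
`∫_{K'} ‖f‖² dLeb ≤ M₁ ∫_{K'} petersson k f dμ_B` (`BergmanIntegral.setIntegral_bergmanBall`);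
and the unfolding bound (`FundamentalDomainUnfolding.exists_card_setIntegral_petersson_le`) gives
`∫_{K'} petersson k f dμ_B ≤ N ∫_D petersson k f dμ_B`.
-/

namespace Summit.Ventures.HodgeRepro2.ShimuraData

open MeasureTheory Metric Set Real
open scoped Real

variable {K : Type*} [Field K] [NumberField K] [NumberField.IsCMField K] {τ₁ : K →+* ℂ}
  {H : Matrix (Fin 3) (Fin 3) K} {Q : Matrix (Fin 3) (Fin 3) ℂ} (hQ : IsFrame K τ₁ H Q)
  (S : Subgroup (GL (Fin 3) K)) (hS : (S : Set (GL (Fin 3) K)) ⊆ unitaryGroup K H)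

/-- The weight factor `(1 − ‖z‖²)³ / (1 − ‖z‖²)^k` relating the Lebesgue density `‖f‖²` to the
Bergman–Petersson density `volumeDensity · petersson k f`. -/
noncomputable def weightFactor (k : ℕ) (z : Fin 2 → ℂ) : ℝ :=
  (1 - normSq₂ z) ^ 3 * ((1 - normSq₂ z) ^ k)⁻¹

/-- `1 - ‖z‖² ≠ 0` on the ball. -/
theorem one_sub_normSq₂_ne_zero {z : Fin 2 → ℂ} (hz : z ∈ ball₂) : 1 - normSq₂ z ≠ 0 := by
  have := normSq₂_lt_one hz
  linarith

/-- On the ball, `‖f z‖² = weightFactor k z · (volumeDensity z · petersson k f z)`. -/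
theorem norm_sq_eq_weightFactor_mul (k : ℕ) (f : (Fin 2 → ℂ) → ℂ) {z : Fin 2 → ℂ}
    (hz : z ∈ ball₂) :
    ‖f z‖ ^ 2 = weightFactor k z * (volumeDensity z * petersson k f z) := by
  have h := one_sub_normSq₂_ne_zero hz
  simp only [weightFactor, volumeDensity, petersson]
  field_simp

/-- The weight factor is continuous on the ball. -/
theorem continuousOn_weightFactor (k : ℕ) : ContinuousOn (weightFactor k) ball₂ := by
  refine ContinuousOn.mul ?_ ?_
  · exact ((continuous_const.sub continuous_normSq₂).pow 3).continuousOn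
  · refine ContinuousOn.inv₀ ((continuous_const.sub continuous_normSq₂).pow k).continuousOn ?_
    intro z hz
    exact pow_ne_zero _ (one_sub_normSq₂_ne_zero hz)

/-- **The Petersson sup bound.** For a compact quotient `S\𝔹²` (with `S` acting properly
discontinuously), a compact `C ⊂ 𝔹²`, a measurable fundamental domain `D` and a weight `k`, there
is `c ≥ 0` such that every holomorphic weight-`k` form `f` for `S` satisfies
`‖f z‖² ≤ c · ∫_D petersson k f dμ_B` for all `z ∈ C`. -/
theorem exists_sup_bound_petersson [CompactSpace (ballQuotient hQ S hS)]
    (hpd : @ProperlyDiscontinuousSMul S ball₂ _ (frameAction hQ S hS).toSMul)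
    {C : Set (Fin 2 → ℂ)} (hC : IsCompact C) (hCb : C ⊆ ball₂) {D : Set ball₂}
    (hD : IsBallFundamentalDomain hQ S hS D) (k : ℕ) :
    ∃ c : ℝ, 0 ≤ c ∧ ∀ {f : (Fin 2 → ℂ) → ℂ}, IsWeightFor τ₁ Q S k f →
      DifferentiableOn ℂ f ball₂ → ∀ z ∈ C,
        ‖f z‖ ^ 2 ≤ c * ∫ w in D, petersson k f (w : Fin 2 → ℂ) ∂bergmanBall := by
  -- the closed thickening `K'` of `C` inside the ball
  obtain ⟨r, hr, hK'⟩ := hC.exists_cthickening_subset_open isOpen_ball₂ hCb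
  set K' := cthickening r C with hK'def
  have hK'c : IsCompact K' := hC.cthickening
  have hK'm : MeasurableSet K' := hK'c.isClosed.measurableSet
  -- its preimage in the ball subtype
  set K'' : Set ball₂ := Subtype.val ⁻¹' K' with hK''def
  have hK''img : Subtype.val '' K'' = K' := by
    rw [hK''def, Subtype.image_preimage_coe, inter_eq_right.mpr hK']
  have hK''c : IsCompact K'' := by
    rw [Subtype.isCompact_iff, hK''img]
    exact hK'c
  have hK''m : MeasurableSet K'' := hK'm.preimage measurable_subtype_coe
  -- the unfolding constant
  obtain ⟨N, hN⟩ := exists_card_setIntegral_petersson_le hQ S hS hpd hK''c hD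
  -- the weight factor is bounded on `K'`
  obtain ⟨M₁, hM₁⟩ := hK'c.exists_bound_of_continuousOn ((continuousOn_weightFactor k).mono hK')
  have hpos : 0 < π * r ^ 2 := by positivity
  refine ⟨((π * r ^ 2) ^ 2)⁻¹ * (max M₁ 0 * N), by positivity, ?_⟩
  intro f hf hdiff z hz
  have hfc : ContinuousOn f ball₂ := hdiff.continuousOn
  -- Step 1: the polydisc mean value bound at `z`
  have hball : ball z r ⊆ K' := ball_subset_closedBall.trans (closedBall_subset_cthickening hz r)
  have hfd : DiffContOnCl ℂ f (ball z r) := by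
    refine ⟨hdiff.mono (hball.trans hK'), ?_⟩
    rw [closure_ball z hr.ne']
    exact hfc.mono ((closedBall_subset_cthickening hz r).trans hK')
  have h1 := PolydiscMeanValue.norm_sq_le_integral_ball hfd hr
  -- Step 2: enlarge the domain of integration to `K'`
  have hcontK' : ContinuousOn (fun w => ‖f w‖ ^ 2) K' := ((hfc.mono hK').norm).pow 2
  have hintK' : IntegrableOn (fun w => ‖f w‖ ^ 2) K' volume := hcontK'.integrableOn_compact hK'c
  have h2 : ∫ w in ball z r, ‖f w‖ ^ 2 ≤ ∫ w in K', ‖f w‖ ^ 2 := by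
    refine setIntegral_mono_set hintK' ?_ (Filter.Eventually.of_forall hball)
    exact Filter.Eventually.of_forall fun w => by positivity
  -- Step 3: compare with the Bergman–Petersson density on `K'`
  have hcontP : ContinuousOn (fun w => volumeDensity w * petersson k f w) K' := by
    refine ContinuousOn.mul ?_ ((continuousOn_petersson k hfc).mono hK')
    refine ContinuousOn.inv₀ ((continuous_const.sub continuous_normSq₂).pow 3).continuousOn ?_
    intro w hw
    exact pow_ne_zero _ (one_sub_normSq₂_ne_zero (hK' hw))
  have hintP : IntegrableOn (fun w => volumeDensity w * petersson k f w) K' volume :=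
    hcontP.integrableOn_compact hK'c
  have h3 : ∫ w in K', ‖f w‖ ^ 2 ≤ ∫ w in K', max M₁ 0 * (volumeDensity w * petersson k f w) := by
    refine setIntegral_mono_on hintK' (hintP.const_mul _) hK'm fun w hw => ?_
    rw [norm_sq_eq_weightFactor_mul k f (hK' hw)]
    have hw0 : 0 ≤ volumeDensity w * petersson k f w := by
      refine mul_nonneg ?_ (petersson_nonneg k f (hK' hw))
      simp only [volumeDensity]
      have : 0 < 1 - normSq₂ w := by
        have := normSq₂_lt_one (hK' hw)
        linarith
      positivity
    refine mul_le_mul_of_nonneg_right ?_ hw0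
    exact (le_abs_self _).trans ((Real.norm_eq_abs _ ▸ hM₁ w hw).trans (le_max_left _ _))
  -- Step 4: the Bergman integral over `K''` and the unfolding bound
  have h4 : ∫ w in K', volumeDensity w * petersson k f w
      = ∫ w in K'', petersson k f (w : Fin 2 → ℂ) ∂bergmanBall := by
    rw [setIntegral_bergmanBall hK''m (fun w => petersson k f w), hK''img]
    simp only [smul_eq_mul]
  have h5 := hN hf hfc
  -- assemble
  have hPet : 0 ≤ ∫ w in D, petersson k f (w : Fin 2 → ℂ) ∂bergmanBall :=
    integral_nonneg fun w => petersson_nonneg k f w.2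
  calc ‖f z‖ ^ 2 ≤ ((π * r ^ 2) ^ 2)⁻¹ * ∫ w in ball z r, ‖f w‖ ^ 2 := h1
    _ ≤ ((π * r ^ 2) ^ 2)⁻¹ * ∫ w in K', ‖f w‖ ^ 2 := by gcongr
    _ ≤ ((π * r ^ 2) ^ 2)⁻¹ * ∫ w in K', max M₁ 0 * (volumeDensity w * petersson k f w) := by
        gcongr
    _ = ((π * r ^ 2) ^ 2)⁻¹ * (max M₁ 0 * ∫ w in K'', petersson k f (w : Fin 2 → ℂ) ∂bergmanBall) := by
        rw [integral_const_mul, h4]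
    _ ≤ ((π * r ^ 2) ^ 2)⁻¹ * (max M₁ 0 * (N * ∫ w in D, petersson k f (w : Fin 2 → ℂ) ∂bergmanBall)) := by
        gcongr
    _ = ((π * r ^ 2) ^ 2)⁻¹ * (max M₁ 0 * N) * ∫ w in D, petersson k f (w : Fin 2 → ℂ) ∂bergmanBall := by
        ring

end Summit.Ventures.HodgeRepro2.ShimuraData
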